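import Literature.AnabelianGeometry.SemiGraphs.TemperedReconstructionCompatRefutation
import Literature.AnabelianGeometry.SemiGraphs.TemperedReconstructionCor39UpToTwistProofs
import HarnessLib

/-!
# `¬ Cor39CompatUpToTwist`: the ∀-countable typed form of [SemiAnbd] Cor 3.9 in the L3 READING OF RECORD
# (compatible Def 3.8, «induced up to the 2-cells of Rmk 2.4.2») is false as typed, at the pair
# (one-vertex `B(F̂₂⁽ᵖ⁾)`, `𝒢_θ(p, n)`)

Mochizuki, *Semi-graphs of anabelioids*, Publ. RIMS **42** (2006) [MochizukiSemiAnbd2006], §3, Corollary 3.9,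
manuscript pp. 42–43 [cite: MochizukiSemiAnbd2006, Cor 3.9 p.42]; Remark 2.4.2 p. 26 (the 2-cells).  The cell's
reading of record of the Cor 3.9 node (abc-iut-L3-lead rulings χ2 / ξ2; abc-iut-w4-d080's `Cor39CompatUpToTwist`,
third conjunct of `Summit.ABC.IUTFork.Conditional.Layer3ResidualOfRecord`) quantifies over ALL countable graphs of
anabelioids satisfying the printed hypotheses; at FINITE pairs it is a THEOREM (`cor39CompatUpToTwistAt`, w4-d080
p419088; `cor39CompatUpToTwistAt_of_finite`, abc-iut-w4-d064 p431134).

PROOF-ONLY file (abc-iut cell, F-wave seat abc-iut-f-175 gen 2; 0 definitions, no named fact): the witness of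
`TemperedReconstructionCompatRefutation.lean` (p453900) — `φ := ζ ∘ χ_a` from the one-vertex graph `B(F̂₂⁽²⁾)` onto
the escaping MAXIMAL compact subgroup of `π₁^temp(𝒢_θ(2, k ↦ k+1))` — kills clause (b) of the up-to-twist twin as
well: «induced up to twist» implies «compatible on verticial homomorphisms» for EVERY conjugator family
(abc-iut-w4-d080's `Hom.compat_of_inducesUpToTwist`), and no morphism is compatible with `φ`
(`not_compatV_of_range_not_le`).  Hence `not_cor39CompatUpToTwist : ¬ Cor39CompatUpToTwist.{0}` — so ALL THREE
conjuncts of `Layer3ResidualOfRecord.{0}` are now kernel-refuted (p442260, p443103, this file): that binder is VACUOUS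
and the certificate path must use the finite form `layer3ConeFinite_holds` (hypothesis-free) — which it does (REVISION
v2 of `Conditional/Layer3OfS.lean`).  HONEST FRAMING: ∀-countable TYPING only (an infinite graph where «maximal compact
= verticial» fails); Cor 3.9 as printed / as used in IUT (finite dual semi-graphs) untouched; no side on [IUTchIII]
Cor. 3.12.
-/

noncomputable section

namespace Literature.AnabelianGeometry.SemiGraphs

namespace ProfiniteSemiGraph

open CategoryTheory Topology Multiplicative
open Literature.AlgebraicGeometry.Frobenioids (IsSlimGroup)

section Witness

variable {P : Type} [Group P] [TopologicalSpace P] [IsTopologicalGroup P] [CompactSpace P]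
  [TotallyDisconnectedSpace P] [SecondCountableTopology P]

/-- **`Cor39CompatUpToTwist` fails at (`OneVertex.graph P`, `ℋ`)** for `P` slim with a level family and
`φ : P →ₜ* π₁^temp(ℋ)` onto a maximal compact subgroup lying in no verticial subgroup: clause (b) would give a locally
open `F` inducing `φ` UP TO TWIST, hence compatible with `φ` on verticial homomorphisms (`Hom.compat_of_inducesUpToTwist`).
[cite: MochizukiSemiAnbd2006, Cor 3.9 p.42] -/
theorem not_cor39CompatUpToTwist_of_witness (L : LevelFamily P) (hslim : IsSlimGroup P)
    {ℋ : ProfiniteSemiGraph.{0}} (hℋ : Cor39Hypotheses ℋ) (cℋ : TemperedPiChart ℋ) (φ : P →ₜ* cℋ.G)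
    (hmax : IsMaximalCompactSubgroup φ.toMonoidHom.range)
    (hnv : ¬ ∃ (v : ℋ.graph.Vertex) (H : Subgroup cℋ.G), H ∈ verticialSubgroups cℋ v ∧
      φ.toMonoidHom.range ≤ H) :
    ¬ Cor39CompatUpToTwist.{0} := by
  intro hC
  have h𝒢 : Cor39Hypotheses (OneVertex.graph P) :=
    ⟨OneVertex.prop36Hypotheses L hslim, OneVertex.isTotallyEstranged, ⟨fun b => nomatch b⟩⟩
  obtain ⟨F, -, hind, -⟩ := (hC (OneVertex.graph P) ℋ h𝒢 hℋ (OneVertex.chart L) cℋ).2 φ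
    (isCompatiblyQuasiGeometric_of_range_isMaximalCompactSubgroup φ hmax)
  exact not_compatV_of_range_not_le L hℋ.thm37Hypotheses cℋ φ hnv F
    (F.compat_of_inducesUpToTwist (OneVertex.chart L) cℋ φ hind).1

end Witness

open Literature.AnabelianGeometry.SemiGraphs.FreeProPRankTwo in
/-- **`¬ Cor39CompatUpToTwist`** — witness (`OneVertex.graph (F̂₂⁽²⁾)`, `𝒢_θ(2, k ↦ k+1)`, `φ := ζ ∘ χ_a`).  With
p442260 (`not_compactInVerticial`) and p443103 (`not_maximalCompactIffVerticial`) all three conjuncts of the ∀-countable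
`Layer3ResidualOfRecord.{0}` are refuted; repaired statement: `cor39CompatUpToTwistAt_of_finite` (PROVED).
[cite: MochizukiSemiAnbd2006, Cor 3.9 p.42] -/
theorem not_cor39CompatUpToTwist : ¬ Cor39CompatUpToTwist.{0} := by
  haveI : Fact (Nat.Prime 2) := ⟨Nat.prime_two⟩
  obtain ⟨h36, ζ, h37, hmax, hnv⟩ :=
    thetaRayFreeProP_exists_maximalCompact_escaping 2 (fun k => k + 1) (fun k => Nat.le_succ k)
  obtain ⟨L⟩ := nonempty_levelFamily_grp 2
  haveI : SecondCountableTopology (Grp 2) := secondCountableTopology_grp 2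
  have hℋ : Cor39Hypotheses (thetaRayFreeProP 2 fun k => k + 1) :=
    ⟨h36, h37.isTotallyEstranged, thetaRay_isGraph (G := Grp 2) (E := Multiplicative ℤ_[2]) (up := α 2)
      (low := fun k => θα 2 (k + 1))⟩
  have hrange : (ζ.comp (χa 2)).toMonoidHom.range = ζ.toMonoidHom.range := by
    change (ζ.toMonoidHom.comp (χa 2).toMonoidHom).range = _
    rw [MonoidHom.range_comp, MonoidHom.range_eq_top.mpr (χa_surjective 2), ← MonoidHom.range_eq_map]
  refine not_cor39CompatUpToTwist_of_witness L (isSlimGroup 2) hℋ _ (ζ.comp (χa 2)) ?_ ?_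
  · rw [hrange]; exact hmax
  · rw [hrange]; exact hnv

end ProfiniteSemiGraph

end Literature.AnabelianGeometry.SemiGraphs

end
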